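import Summits.PneNP.PneNP.Theorems.ConvexRankGatesCaptureTJoinSpan
import Summits.PneNP.PneNP.Theorems.ConvexRankGatesCaptureDualSpan
import HarnessLib

/-!
# Crux `Capture` (stmt-PneNP-2659) — the graphic `𝔽₂`-span door sits in GRANK ∩ PERM, and its dual
# (T-CUT) in PERM

Book-keeping around the new positive theorem `graphicSpan_isGRankGate` (graphic `𝔽₂`-span membership —
`T`-join existence — is ONE GRANK gate): the SAME function is of course also ONE PERM gate on `2|V|` points
(`graphicSpan_isPermGate`: it is an abelian group program over `𝔽₂^V`, `abelianProgram_isPermGate`), and its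
Boolean dual — `[Σ_j e_{τ j} ∉ span_{𝔽₂} {e_{p i} + e_{q i} : v i = 0}]` = "the selected edges contain a
`T`-odd cut" (`T`-CUT) — is ONE PERM gate on `2(n+1)` points by span-program duality
(`tCut_onePermGate`, from `dualSpan_onePermGate`). So for this instance the duality audit of the crux is
complete in the kernel: door in GRANK ∩ PERM, dual door in PERM; whether the dual is also one GRANK gate is
open (cf. the `DualGRank` cell of `Cruxes/Capture/DUALITY-AUDIT-c7.md`). [folklore]
-/

namespace Summit.PneNP.PneNP.Theorems.Capture.TJoin

set_option linter.dupNamespace false -- `Summit.PneNP.PneNP.…`: summit = sub-problem (D-0017)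

open Literature.Computability.Complexity
open Summit.PneNP.PneNP.Theorems.CliqueExtLowerBound.Negative (abelianProgram_isPermGate)
open Summit.PneNP.PneNP.Theorems (mem_closure_image_iff_mem_span)
open Summit.PneNP.PneNP.Theorems.Capture.DualityAudit (dualSpan_onePermGate)

noncomputable section

/-- **The graphic `𝔽₂`-span door is ONE PERM gate on `2|V|` points (registered sub-goal
`graphicSpan_isPermGate`)**: `v ↦ [Σ_j e_{τ j} ∈ span_{𝔽₂} {e_{p i} + e_{q i} : v i = 1}]` is an abelian
group program over `𝔽₂^V`. Together with `graphicSpan_isGRankGate` the door lies in GRANK ∩ PERM.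
[folklore] -/
theorem graphicSpan_isPermGate : ∀ (V : Type) [Fintype V] [DecidableEq V] (n k : ℕ)
    (p q : Fin n → V) (τ : Fin k → V) (f : (Fin n → Bool) → Bool),
    (∀ v, f v = true ↔ (∑ j, Pi.single (τ j) (1 : ZMod 2) : V → ZMod 2) ∈
      Submodule.span (ZMod 2) ((fun i => (Pi.single (p i) (1 : ZMod 2) + Pi.single (q i) 1 : V → ZMod 2)) ''
        {i | v i = true})) →
    IsPermGate (2 * Fintype.card V) ⟨n, f⟩ := by
  intro V _ _ n k p q τ f hf
  have h := abelianProgram_isPermGate (G := ZMod 2) (κ := V)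
    (fun i => (Pi.single (p i) (1 : ZMod 2) + Pi.single (q i) 1 : V → ZMod 2))
    (∑ j, Pi.single (τ j) (1 : ZMod 2)) f fun v => by
      rw [hf v]
      have key := mem_closure_image_iff_mem_span (fun x : V → ZMod 2 => Multiplicative.ofAdd x) rfl
        (fun _ _ => rfl) Multiplicative.ofAdd.injective
        ((fun i => (Pi.single (p i) (1 : ZMod 2) + Pi.single (q i) 1 : V → ZMod 2)) '' {i | v i = true})
        (∑ j, Pi.single (τ j) (1 : ZMod 2))
      rw [Set.image_image] at key
      exact key.symm
  have hcard : Fintype.card (ZMod 2 × V) = 2 * Fintype.card V := by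
    rw [Fintype.card_prod, ZMod.card]
  rw [hcard] at h
  exact h

/-- **The dual door T-CUT is ONE PERM gate on `2(n+1)` points**: `v ↦ [Σ_j e_{τ j} ∉ span_{𝔽₂}
{e_{p i} + e_{q i} : v i = 0}]` — for distinct terminals: the UNselected edges contain no `T`-join, i.e.
the selected edges contain a `T`-odd cut — by span-program duality (`dualSpan_onePermGate`). [folklore] -/
theorem tCut_onePermGate {V : Type} [Fintype V] [DecidableEq V] {n k : ℕ} (p q : Fin n → V)
    (τ : Fin k → V) (f : (Fin n → Bool) → Bool)
    (hf : ∀ v, f v = true ↔ (∑ j, Pi.single (τ j) (1 : ZMod 2) : V → ZMod 2) ∉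
      Submodule.span (ZMod 2) ((fun i => (Pi.single (p i) (1 : ZMod 2) + Pi.single (q i) 1 : V → ZMod 2)) ''
        {i | v i = false})) :
    IsPermGate (2 * (n + 1)) ⟨n, f⟩ := by
  have h := dualSpan_onePermGate (V → ZMod 2) n
    (fun i => (Pi.single (p i) (1 : ZMod 2) + Pi.single (q i) 1 : V → ZMod 2))
    (∑ j, Pi.single (τ j) (1 : ZMod 2)) f
  exact h hf

end

end Summit.PneNP.PneNP.Theorems.Capture.TJoin
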